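import Mathlib
import Summits.NavierStokesRegularity.NavierStokesRegularity.Theorems.EulerZoomLiouvillePowerGaugeEulerLiouvilleMirrorMomentAxialFluxPointwise
import HarnessLib

/-!
# Crux `EulerZoomLiouville.PowerGaugeEulerLiouville` (stmt-NavierStokesRegularity-19832), line `mirror-moment`, towards stub M1:
# THE AXIAL FLUX SIGN LEMMA (Choi–Jeong's identity as an inequality): `∫ v₂ · (r ω_θ)/r² dx ≥ 0` for an axisymmetric swirl-free
# divergence-free `C¹` field with bounded, square-integrable velocity and integrable ledger density `|curl v|/r`

Route №10 `EulerZoomLiouville` (NavierStokesRegularity), crux E.  Line `mirror-moment` (ideator ns-idea-11 g3;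
`Cruxes/PowerGaugeEulerLiouville/Lines/mirror_moment.lean`), lever M1 `stub_momentMonotone` (owner ns-sfl-p1 g3 per LEAD; this file is
the analytic SIGN input, landed as a brick).  For one slice `v` (classical swirl-free axisymmetric Euler velocity at a past time) the axial
ledger moment `∫ |x₂| η`, `η = |curl v|/r`, moves at the rate `∫ v₂ ξ`, `ξ = ω_θ/r = swirl(curl v)/r²` (transport of `ξ`, `div v = 0`), and the
content of Choi–Jeong's Lemma 3.3 (AJM 2025 = arXiv:2110.09079 p. 12, time-reversed orientation; planar ancestor Iftimie–Sideris–Gamblin 1999)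
is that this rate has a SIGN: `∫ v₂ ξ dx = 2π∬ v_z ω_θ dr dz = π∫_{axis} v_z² dz + ∫ v_r²/r² dx ≥ 0`.

THE PROOF HERE never leaves `ℝ³` and needs no boundary term on the axis: with the regularised weight `q_ε = (r²+ε²)⁻¹` and the tree's smooth
cut-off `χ_R` (`WholeSpaceIBP.cutoff`), part 1 (`…MirrorMomentAxialFluxPointwise.axialFlux_integrand_decomposition`) writes
`χ_R q_ε v₂ · swirl(curl v)` as `χ_R q_ε² (ε² v₂² + r²(v₀²+v₁²))` (two squares) plus cut-off errors `≤ (3D/2ε)·‖v‖²` pointwise (`D = sup ‖Dχ_R‖ ≤ C/R`)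
plus three exact derivatives (`∂₂(·)` and two divergences of compactly supported `C¹` fields), whose integrals vanish
(`integral_fderiv_apply_eq_zero`, `integral_divergence_eq_zero`).  Hence `∫ χ_R q_ε v₂ swirl(curl v) ≥ −(3C/(2εR)) ∫‖v‖²`
(`integral_truncated_axialFlux_ge`); along `ε = 1/(n+1)`, `R = (n+1)²` the left side tends to `∫ v₂ swirl(curl v)/r²` by dominated convergence
against `sup‖v‖ · |curl v|/r` (`|swirl(curl v)| ≤ r |curl v|`, `q_ε ≤ r⁻²`), and the right side tends to `0`.

* `integral_truncated_axialFlux_ge` — the truncated, regularised inequality for any `C¹` compactly supported cut-off;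
* **`integral_axialFlux_nonneg`** — `0 ≤ ∫ x, v x 2 * (swirl (curl v) x / cylRadius x ^ 2)`.

WHAT THIS IS NOT: not NS, not the crux, not M1 itself — a helper `--supports` stmt-19832 (the sign brick of the axial-moment monotonicity
for the line `mirror-moment`; the transport/derivative half of M1 and the stratum wiring are the M1 owner's); nothing here bears on NS
regularity.  [cite: ChoiJeong2025, Lemma 3.3 (arXiv:2110.09079 p. 12); Leray1934, §6 (1.11) (integration by parts without boundary)]
-/

noncomputable section

-- flat `Theorems/<Route><Decl>…` files of one crux share the namespace of the crux (tree convention)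
set_option linter.dupNamespace false

open MeasureTheory Set Filter Topology Metric Function
open scoped NNReal ENNReal RealInnerProductSpace

namespace Summit.NavierStokesRegularity.NavierStokesRegularity.Theorems.PowerGaugeEulerLiouville.MirrorMoment

open Literature.Analysis Literature.Analysis.FluidPDE

variable {v : EuclideanSpace ℝ (Fin 3) → EuclideanSpace ℝ (Fin 3)}

/-! ### Elementary pointwise bounds -/

/-- `|x₀|, |x₁| ≤ r = √(x₀²+x₁²)`, `r² = x₀²+x₁²`, and `r · (r²+ε²)⁻¹ ≤ (2ε)⁻¹` for `ε > 0`. [folklore] -/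
theorem horizontal_bounds (x : EuclideanSpace ℝ (Fin 3)) {ε : ℝ} (hε : 0 < ε) :
    |x 0| ≤ Real.sqrt (x 0 ^ 2 + x 1 ^ 2) ∧ |x 1| ≤ Real.sqrt (x 0 ^ 2 + x 1 ^ 2) ∧
      Real.sqrt (x 0 ^ 2 + x 1 ^ 2) * (x 0 ^ 2 + x 1 ^ 2 + ε ^ 2)⁻¹ ≤ (2 * ε)⁻¹ := by
  set r := Real.sqrt (x 0 ^ 2 + x 1 ^ 2) with hr
  have hr0 : 0 ≤ r := Real.sqrt_nonneg _
  have hr2 : r ^ 2 = x 0 ^ 2 + x 1 ^ 2 := Real.sq_sqrt (by positivity)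
  refine ⟨Real.abs_le_sqrt (by nlinarith [sq_nonneg (x 1)]), Real.abs_le_sqrt (by nlinarith [sq_nonneg (x 0)]), ?_⟩
  rw [← hr2, ← one_div, ← one_div, mul_one_div, div_le_div_iff₀ (by positivity) (by positivity)]
  nlinarith [sq_nonneg (r - ε)]

/-- The components and the norm: `v₀² + v₁² + v₂² = ‖v‖²` and `|vᵢ| ≤ ‖v‖`. [folklore] -/
theorem sq_sum_eq_norm_sq (w : EuclideanSpace ℝ (Fin 3)) : w 0 ^ 2 + w 1 ^ 2 + w 2 ^ 2 = ‖w‖ ^ 2 := by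
  rw [EuclideanSpace.norm_eq, Real.sq_sqrt (by positivity)]
  simp [Fin.sum_univ_three, sq_abs]

/-- **Domination of the regularised integrand**: `|χ q_ε v₂ swirl(curl v)| ≤ B · |curl v|/r` when `|χ| ≤ 1`, `‖v‖ ≤ B`
(`|swirl(curl v)| ≤ r|curl v|`, `q_ε ≤ r⁻²`; on the axis both sides vanish). [folklore] -/
theorem abs_truncated_integrand_le {χ : EuclideanSpace ℝ (Fin 3) → ℝ} (hχ1 : ∀ x, |χ x| ≤ 1) {B : ℝ} (hB : ∀ x, ‖v x‖ ≤ B)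
    (ε : ℝ) (x : EuclideanSpace ℝ (Fin 3)) :
    |χ x * (x 0 ^ 2 + x 1 ^ 2 + ε ^ 2)⁻¹ * v x 2 * swirl (curl v) x| ≤ B * (‖curl v x‖ / cylRadius x) := by
  have hB0 : 0 ≤ B := (norm_nonneg _).trans (hB x)
  by_cases hr : cylRadius x = 0
  · rw [swirl_eq_zero_of_cylRadius_eq_zero _ hr, hr]
    simp
  have hr0 : 0 < cylRadius x := (cylRadius_nonneg x).lt_of_ne' hr
  have hrsq : cylRadius x ^ 2 = x 0 ^ 2 + x 1 ^ 2 := cylRadius_sq x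
  -- `|s| ≤ r ‖ω‖`
  have hs : |swirl (curl v) x| ≤ cylRadius x * ‖curl v x‖ := by
    rw [swirl_eq_inner_rotGen]
    calc |⟪rotGen x, curl v x⟫| ≤ ‖rotGen x‖ * ‖curl v x‖ := abs_real_inner_le_norm _ _
      _ = cylRadius x * ‖curl v x‖ := by rw [norm_rotGen]; rfl
  -- `q ≤ r⁻²`
  have hq0 : 0 < x 0 ^ 2 + x 1 ^ 2 + ε ^ 2 := by rw [← hrsq]; positivity
  have hpos : 0 < x 0 ^ 2 + x 1 ^ 2 := by rw [← hrsq]; positivity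
  have hq : (x 0 ^ 2 + x 1 ^ 2 + ε ^ 2)⁻¹ ≤ (cylRadius x ^ 2)⁻¹ := by
    rw [hrsq]
    exact inv_anti₀ hpos (by nlinarith [sq_nonneg ε])
  have hf : |v x 2| ≤ B := le_trans (by simpa using PiLp.norm_apply_le (v x) 2) (hB x)
  rw [abs_mul, abs_mul, abs_mul, abs_of_pos (inv_pos.2 hq0)]
  calc |χ x| * (x 0 ^ 2 + x 1 ^ 2 + ε ^ 2)⁻¹ * |v x 2| * |swirl (curl v) x|
      ≤ 1 * (cylRadius x ^ 2)⁻¹ * B * (cylRadius x * ‖curl v x‖) :=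
        mul_le_mul (mul_le_mul (mul_le_mul (hχ1 x) hq (inv_pos.2 hq0).le zero_le_one) hf (abs_nonneg _)
          (mul_nonneg zero_le_one (inv_nonneg.2 (sq_nonneg _)))) hs (abs_nonneg _)
          (mul_nonneg (mul_nonneg zero_le_one (inv_nonneg.2 (sq_nonneg _))) hB0)
    _ = B * (‖curl v x‖ / cylRadius x) := by
        field_simp

/-- **Pointwise bound on the cut-off errors**: with `‖Dχ(x)‖ ≤ D` and `ε > 0`,
`|q (Dχ[x_h]) ½(v₂² − v₀² − v₁²) − q h v₂ (Dχ[e₂])| ≤ (3D/(2ε)) ‖v‖²`. [folklore] -/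
theorem abs_cutoff_error_le {χ : EuclideanSpace ℝ (Fin 3) → ℝ} {D : ℝ} (hD : ∀ x, ‖fderiv ℝ χ x‖ ≤ D) {ε : ℝ} (hε : 0 < ε)
    (x : EuclideanSpace ℝ (Fin 3)) :
    |(x 0 ^ 2 + x 1 ^ 2 + ε ^ 2)⁻¹ *
          fderiv ℝ χ x ((x 0) • EuclideanSpace.single 0 (1 : ℝ) + (x 1) • EuclideanSpace.single 1 (1 : ℝ)) *
          (2⁻¹ * (v x 2 ^ 2 - (v x 0 ^ 2 + v x 1 ^ 2)))
        - (x 0 ^ 2 + x 1 ^ 2 + ε ^ 2)⁻¹ * (x 0 * v x 0 + x 1 * v x 1) * v x 2 * fderiv ℝ χ x (EuclideanSpace.single 2 (1 : ℝ))|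
      ≤ 3 * D / (2 * ε) * ‖v x‖ ^ 2 := by
  obtain ⟨hx0, hx1, hrq⟩ := horizontal_bounds x hε
  set r := Real.sqrt (x 0 ^ 2 + x 1 ^ 2) with hr
  set q := (x 0 ^ 2 + x 1 ^ 2 + ε ^ 2)⁻¹ with hqdef
  have hq0 : 0 < q := by rw [hqdef]; positivity
  have hr0 : 0 ≤ r := Real.sqrt_nonneg _
  have hD0 : 0 ≤ D := (norm_nonneg _).trans (hD x)
  have hnsq := sq_sum_eq_norm_sq (v x)
  -- components against the norm
  have hv0 : |v x 0| ≤ ‖v x‖ := by simpa using PiLp.norm_apply_le (v x) 0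
  have hv1 : |v x 1| ≤ ‖v x‖ := by simpa using PiLp.norm_apply_le (v x) 1
  have hv2 : |v x 2| ≤ ‖v x‖ := by simpa using PiLp.norm_apply_le (v x) 2
  -- derivative values against `D`
  have hDe : ∀ w : EuclideanSpace ℝ (Fin 3), |fderiv ℝ χ x w| ≤ D * ‖w‖ := fun w =>
    (Real.norm_eq_abs _ ▸ (fderiv ℝ χ x).le_opNorm w).trans (mul_le_mul_of_nonneg_right (hD x) (norm_nonneg _))
  have hD2 : |fderiv ℝ χ x (EuclideanSpace.single 2 (1 : ℝ))| ≤ D := by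
    simpa using hDe (EuclideanSpace.single 2 (1 : ℝ))
  have hDh : |fderiv ℝ χ x ((x 0) • EuclideanSpace.single 0 (1 : ℝ) + (x 1) • EuclideanSpace.single 1 (1 : ℝ))| ≤ 2 * D * r := by
    rw [map_add, map_smul, map_smul, smul_eq_mul, smul_eq_mul]
    have h0 : |fderiv ℝ χ x (EuclideanSpace.single 0 (1 : ℝ))| ≤ D := by simpa using hDe (EuclideanSpace.single 0 (1 : ℝ))
    have h1 : |fderiv ℝ χ x (EuclideanSpace.single 1 (1 : ℝ))| ≤ D := by simpa using hDe (EuclideanSpace.single 1 (1 : ℝ))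
    calc |x 0 * fderiv ℝ χ x (EuclideanSpace.single 0 1) + x 1 * fderiv ℝ χ x (EuclideanSpace.single 1 1)|
        ≤ |x 0| * |fderiv ℝ χ x (EuclideanSpace.single 0 1)| + |x 1| * |fderiv ℝ χ x (EuclideanSpace.single 1 1)| := by
          refine (abs_add_le _ _).trans ?_
          rw [abs_mul, abs_mul]
      _ ≤ r * D + r * D := add_le_add (mul_le_mul hx0 h0 (abs_nonneg _) hr0) (mul_le_mul hx1 h1 (abs_nonneg _) hr0)
      _ = 2 * D * r := by ring
  -- `|h| ≤ 2 r ‖v‖`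
  have hh : |x 0 * v x 0 + x 1 * v x 1| ≤ 2 * r * ‖v x‖ := by
    calc |x 0 * v x 0 + x 1 * v x 1| ≤ |x 0| * |v x 0| + |x 1| * |v x 1| := by
          refine (abs_add_le _ _).trans ?_; rw [abs_mul, abs_mul]
      _ ≤ r * ‖v x‖ + r * ‖v x‖ :=
          add_le_add (mul_le_mul hx0 hv0 (abs_nonneg _) hr0) (mul_le_mul hx1 hv1 (abs_nonneg _) hr0)
      _ = 2 * r * ‖v x‖ := by ring
  -- `|½(f² − v₀² − v₁²)| ≤ ½‖v‖²`
  have hW : |2⁻¹ * (v x 2 ^ 2 - (v x 0 ^ 2 + v x 1 ^ 2))| ≤ 2⁻¹ * ‖v x‖ ^ 2 := by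
    rw [abs_mul, abs_of_pos (by norm_num : (0 : ℝ) < 2⁻¹)]
    refine mul_le_mul_of_nonneg_left (abs_le.2 ⟨?_, ?_⟩) (by norm_num)
    · nlinarith [sq_nonneg (v x 2), hnsq]
    · nlinarith [sq_nonneg (v x 0), sq_nonneg (v x 1), hnsq]
  -- assemble
  have hA : |q * fderiv ℝ χ x ((x 0) • EuclideanSpace.single 0 (1 : ℝ) + (x 1) • EuclideanSpace.single 1 (1 : ℝ)) *
      (2⁻¹ * (v x 2 ^ 2 - (v x 0 ^ 2 + v x 1 ^ 2)))| ≤ q * (2 * D * r) * (2⁻¹ * ‖v x‖ ^ 2) := by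
    rw [abs_mul, abs_mul, abs_of_pos hq0]
    gcongr
  have hBd : |q * (x 0 * v x 0 + x 1 * v x 1) * v x 2 * fderiv ℝ χ x (EuclideanSpace.single 2 (1 : ℝ))| ≤
      q * (2 * r * ‖v x‖) * ‖v x‖ * D := by
    rw [abs_mul, abs_mul, abs_mul, abs_of_pos hq0]
    gcongr
  calc _ ≤ q * (2 * D * r) * (2⁻¹ * ‖v x‖ ^ 2) + q * (2 * r * ‖v x‖) * ‖v x‖ * D := (abs_sub _ _).trans (add_le_add hA hBd)
    _ = 3 * D * (r * q) * ‖v x‖ ^ 2 := by ring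
    _ ≤ 3 * D * (2 * ε)⁻¹ * ‖v x‖ ^ 2 := by gcongr
    _ = 3 * D / (2 * ε) * ‖v x‖ ^ 2 := by rw [div_eq_mul_inv]

/-! ### The truncated, regularised inequality -/

/-- **The truncated inequality.**  For `v ∈ C¹` axisymmetric, swirl-free, divergence-free with `∫‖v‖² < ∞`, a `C¹` compactly supported
cut-off `χ ≥ 0` with `‖Dχ‖ ≤ D`, and `ε > 0`:
`−(3D/(2ε)) ∫‖v‖² ≤ ∫ χ (r²+ε²)⁻¹ v₂ swirl(curl v)`.  Proof: integrate the pointwise decomposition of part 1; the three exact derivatives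
integrate to zero (`integral_fderiv_apply_eq_zero`, `integral_divergence_eq_zero`), the squares are nonnegative, the errors are bounded by
`abs_cutoff_error_le`. [cite: ChoiJeong2025, Lemma 3.3; Leray1934, §6 (1.11)] -/
theorem integral_truncated_axialFlux_ge (hv : ContDiff ℝ 1 v) (hax : IsAxisymmetric v) (hsw : HasNoSwirl v)
    (hdiv : VectorCalculus.IsDivFree v) (hL2 : Integrable fun x => ‖v x‖ ^ 2)
    {χ : EuclideanSpace ℝ (Fin 3) → ℝ} (hχ : ContDiff ℝ 1 χ) (hχc : HasCompactSupport χ) (hχ0 : ∀ x, 0 ≤ χ x)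
    {D : ℝ} (hD : ∀ x, ‖fderiv ℝ χ x‖ ≤ D) {ε : ℝ} (hε : 0 < ε) :
    -(3 * D / (2 * ε) * ∫ x, ‖v x‖ ^ 2) ≤
      ∫ x, χ x * (x 0 ^ 2 + x 1 ^ 2 + ε ^ 2)⁻¹ * v x 2 * swirl (curl v) x := by
  have hεne : ε ≠ 0 := hε.ne'
  -- regularity of the building blocks
  have hq : ContDiff ℝ 1 (fun y : EuclideanSpace ℝ (Fin 3) => (y 0 ^ 2 + y 1 ^ 2 + ε ^ 2)⁻¹) := contDiff_invSq hεne
  have hvi : ∀ i : Fin 3, ContDiff ℝ 1 (fun y => v y i) := fun i => contDiff_apply_coord hv i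
  have hci : ∀ i : Fin 3, ContDiff ℝ 1 (fun y : EuclideanSpace ℝ (Fin 3) => y i) := fun i => contDiff_coord i
  have hh : ContDiff ℝ 1 (fun y : EuclideanSpace ℝ (Fin 3) => y 0 * v y 0 + y 1 * v y 1) :=
    ((hci 0).mul (hvi 0)).add ((hci 1).mul (hvi 1))
  have hxh : ContDiff ℝ 1 (fun y : EuclideanSpace ℝ (Fin 3) =>
      ((y 0) • EuclideanSpace.single 0 (1 : ℝ) + (y 1) • EuclideanSpace.single 1 (1 : ℝ) : EuclideanSpace ℝ (Fin 3))) :=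
    ((hci 0).smul contDiff_const).add ((hci 1).smul contDiff_const)
  have hW1 : ContDiff ℝ 1 (fun y => 2⁻¹ * (v y 0 ^ 2 + v y 1 ^ 2)) := contDiff_const.mul (((hvi 0).pow 2).add ((hvi 1).pow 2))
  have hW2 : ContDiff ℝ 1 (fun y => 2⁻¹ * v y 2 ^ 2) := contDiff_const.mul ((hvi 2).pow 2)
  -- the five pieces
  set G : EuclideanSpace ℝ (Fin 3) → ℝ :=
    fun y => χ y * (y 0 ^ 2 + y 1 ^ 2 + ε ^ 2)⁻¹ * v y 2 * (y 0 * v y 0 + y 1 * v y 1) with hG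
  set w1 : EuclideanSpace ℝ (Fin 3) → EuclideanSpace ℝ (Fin 3) :=
    fun y => (χ y * (y 0 ^ 2 + y 1 ^ 2 + ε ^ 2)⁻¹ * (2⁻¹ * (v y 0 ^ 2 + v y 1 ^ 2))) •
      ((y 0) • EuclideanSpace.single 0 (1 : ℝ) + (y 1) • EuclideanSpace.single 1 (1 : ℝ) : EuclideanSpace ℝ (Fin 3)) with hw1
  set w2 : EuclideanSpace ℝ (Fin 3) → EuclideanSpace ℝ (Fin 3) :=
    fun y => (χ y * (y 0 ^ 2 + y 1 ^ 2 + ε ^ 2)⁻¹ * (2⁻¹ * v y 2 ^ 2)) •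
      ((y 0) • EuclideanSpace.single 0 (1 : ℝ) + (y 1) • EuclideanSpace.single 1 (1 : ℝ) : EuclideanSpace ℝ (Fin 3)) with hw2
  have hG1 : ContDiff ℝ 1 G := ((hχ.mul hq).mul (hvi 2)).mul hh
  have hGc : HasCompactSupport G := by
    rw [hG]
    exact ((hχc.mul_right).mul_right).mul_right
  have hw11 : ContDiff ℝ 1 w1 := ((hχ.mul hq).mul hW1).smul hxh
  have hw21 : ContDiff ℝ 1 w2 := ((hχ.mul hq).mul hW2).smul hxh
  have hw1c : HasCompactSupport w1 := by
    rw [hw1]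
    exact ((hχc.mul_right).mul_right).smul_right
  have hw2c : HasCompactSupport w2 := by
    rw [hw2]
    exact ((hχc.mul_right).mul_right).smul_right
  -- the pointwise decomposition
  have hpt : ∀ x, χ x * (x 0 ^ 2 + x 1 ^ 2 + ε ^ 2)⁻¹ * v x 2 * swirl (curl v) x =
      (χ x * ((x 0 ^ 2 + x 1 ^ 2 + ε ^ 2)⁻¹) ^ 2 * (ε ^ 2 * v x 2 ^ 2 + (x 0 ^ 2 + x 1 ^ 2) * (v x 0 ^ 2 + v x 1 ^ 2))
        + ((x 0 ^ 2 + x 1 ^ 2 + ε ^ 2)⁻¹ *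
              fderiv ℝ χ x ((x 0) • EuclideanSpace.single 0 (1 : ℝ) + (x 1) • EuclideanSpace.single 1 (1 : ℝ))
              * (2⁻¹ * (v x 2 ^ 2 - (v x 0 ^ 2 + v x 1 ^ 2)))
            - (x 0 ^ 2 + x 1 ^ 2 + ε ^ 2)⁻¹ * (x 0 * v x 0 + x 1 * v x 1) * v x 2 *
                fderiv ℝ χ x (EuclideanSpace.single 2 (1 : ℝ))))
        + (fderiv ℝ G x (EuclideanSpace.single 2 (1 : ℝ))
            + (VectorCalculus.divergence w1 x - VectorCalculus.divergence w2 x)) := by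
    intro x
    rw [axialFlux_integrand_decomposition hv hax hsw hdiv hχ hεne x]
    ring
  -- integrability of the pieces (continuous with compact support)
  have hχcont : Continuous χ := hχ.continuous
  have hDχc : Continuous fun x => fderiv ℝ χ x := hχ.continuous_fderiv one_ne_zero
  have hqc : Continuous fun y : EuclideanSpace ℝ (Fin 3) => (y 0 ^ 2 + y 1 ^ 2 + ε ^ 2)⁻¹ := hq.continuous
  have hvc : ∀ i : Fin 3, Continuous fun y => v y i := fun i => (hvi i).continuous
  have hcc : ∀ i : Fin 3, Continuous fun y : EuclideanSpace ℝ (Fin 3) => y i := fun i => (hci i).continuous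
  have hPos_cont : Continuous fun x : EuclideanSpace ℝ (Fin 3) =>
      χ x * ((x 0 ^ 2 + x 1 ^ 2 + ε ^ 2)⁻¹) ^ 2 * (ε ^ 2 * v x 2 ^ 2 + (x 0 ^ 2 + x 1 ^ 2) * (v x 0 ^ 2 + v x 1 ^ 2)) :=
    (hχcont.mul (hqc.pow 2)).mul ((continuous_const.mul ((hvc 2).pow 2)).add
      ((((hcc 0).pow 2).add ((hcc 1).pow 2)).mul (((hvc 0).pow 2).add ((hvc 1).pow 2))))
  have hPos_int : Integrable fun x : EuclideanSpace ℝ (Fin 3) =>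
      χ x * ((x 0 ^ 2 + x 1 ^ 2 + ε ^ 2)⁻¹) ^ 2 * (ε ^ 2 * v x 2 ^ 2 + (x 0 ^ 2 + x 1 ^ 2) * (v x 0 ^ 2 + v x 1 ^ 2)) := by
    refine hPos_cont.integrable_of_hasCompactSupport ?_
    exact (hχc.mul_right).mul_right
  have hErr_cont : Continuous fun x : EuclideanSpace ℝ (Fin 3) =>
      (x 0 ^ 2 + x 1 ^ 2 + ε ^ 2)⁻¹ *
          fderiv ℝ χ x ((x 0) • EuclideanSpace.single 0 (1 : ℝ) + (x 1) • EuclideanSpace.single 1 (1 : ℝ))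
          * (2⁻¹ * (v x 2 ^ 2 - (v x 0 ^ 2 + v x 1 ^ 2)))
        - (x 0 ^ 2 + x 1 ^ 2 + ε ^ 2)⁻¹ * (x 0 * v x 0 + x 1 * v x 1) * v x 2 * fderiv ℝ χ x (EuclideanSpace.single 2 (1 : ℝ)) :=
    ((hqc.mul (hDχc.clm_apply hxh.continuous)).mul (continuous_const.mul (((hvc 2).pow 2).sub
      (((hvc 0).pow 2).add ((hvc 1).pow 2))))).sub
      (((hqc.mul hh.continuous).mul (hvc 2)).mul (hDχc.clm_apply continuous_const))
  have hErr_int : Integrable fun x : EuclideanSpace ℝ (Fin 3) =>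
      (x 0 ^ 2 + x 1 ^ 2 + ε ^ 2)⁻¹ *
          fderiv ℝ χ x ((x 0) • EuclideanSpace.single 0 (1 : ℝ) + (x 1) • EuclideanSpace.single 1 (1 : ℝ))
          * (2⁻¹ * (v x 2 ^ 2 - (v x 0 ^ 2 + v x 1 ^ 2)))
        - (x 0 ^ 2 + x 1 ^ 2 + ε ^ 2)⁻¹ * (x 0 * v x 0 + x 1 * v x 1) * v x 2 * fderiv ℝ χ x (EuclideanSpace.single 2 (1 : ℝ)) := by
    refine hErr_cont.integrable_of_hasCompactSupport ?_
    refine HasCompactSupport.intro (hχc.fderiv (𝕜 := ℝ)) fun x hx => ?_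
    rw [image_eq_zero_of_notMem_tsupport hx]
    simp
  have hT1_int : Integrable fun x => fderiv ℝ G x (EuclideanSpace.single 2 (1 : ℝ)) :=
    ((hG1.continuous_fderiv one_ne_zero).clm_apply continuous_const).integrable_of_hasCompactSupport
      (hGc.fderiv_apply (𝕜 := ℝ) _)
  have hdiv_int : ∀ {w : EuclideanSpace ℝ (Fin 3) → EuclideanSpace ℝ (Fin 3)}, ContDiff ℝ 1 w → HasCompactSupport w →
      Integrable fun x => VectorCalculus.divergence w x := by
    intro w hw hwc
    refine (continuous_divergence (hw.continuous_fderiv one_ne_zero)).integrable_of_hasCompactSupport ?_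
    exact HasCompactSupport.intro hwc fun x hx => divergence_eq_zero_of_notMem_tsupport hx
  have hT2_int := hdiv_int hw11 hw1c
  have hT3_int := hdiv_int hw21 hw2c
  -- integrate: name the pieces
  set Pos : EuclideanSpace ℝ (Fin 3) → ℝ := fun x =>
    χ x * ((x 0 ^ 2 + x 1 ^ 2 + ε ^ 2)⁻¹) ^ 2 * (ε ^ 2 * v x 2 ^ 2 + (x 0 ^ 2 + x 1 ^ 2) * (v x 0 ^ 2 + v x 1 ^ 2)) with hPosDef
  set Err : EuclideanSpace ℝ (Fin 3) → ℝ := fun x =>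
    (x 0 ^ 2 + x 1 ^ 2 + ε ^ 2)⁻¹ *
          fderiv ℝ χ x ((x 0) • EuclideanSpace.single 0 (1 : ℝ) + (x 1) • EuclideanSpace.single 1 (1 : ℝ))
          * (2⁻¹ * (v x 2 ^ 2 - (v x 0 ^ 2 + v x 1 ^ 2)))
        - (x 0 ^ 2 + x 1 ^ 2 + ε ^ 2)⁻¹ * (x 0 * v x 0 + x 1 * v x 1) * v x 2 * fderiv ℝ χ x (EuclideanSpace.single 2 (1 : ℝ))
    with hErrDef
  set T1 : EuclideanSpace ℝ (Fin 3) → ℝ := fun x => fderiv ℝ G x (EuclideanSpace.single 2 (1 : ℝ)) with hT1Def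
  set T2 : EuclideanSpace ℝ (Fin 3) → ℝ := fun x => VectorCalculus.divergence w1 x with hT2Def
  set T3 : EuclideanSpace ℝ (Fin 3) → ℝ := fun x => VectorCalculus.divergence w2 x with hT3Def
  have hpt' : (fun x => χ x * (x 0 ^ 2 + x 1 ^ 2 + ε ^ 2)⁻¹ * v x 2 * swirl (curl v) x) =
      fun x => (Pos x + Err x) + (T1 x + (T2 x - T3 x)) := funext fun x => hpt x
  have hI1 : ∫ x, T1 x = 0 := integral_fderiv_apply_eq_zero hG1 hGc _
  have hI2 : ∫ x, T2 x = 0 := integral_divergence_eq_zero hw11 hw1c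
  have hI3 : ∫ x, T3 x = 0 := integral_divergence_eq_zero hw21 hw2c
  have hsplit : ∫ x, χ x * (x 0 ^ 2 + x 1 ^ 2 + ε ^ 2)⁻¹ * v x 2 * swirl (curl v) x = (∫ x, Pos x) + ∫ x, Err x := by
    rw [hpt']
    have e1 : ∫ x, (Pos x + Err x) + (T1 x + (T2 x - T3 x)) = (∫ x, Pos x + Err x) + ∫ x, T1 x + (T2 x - T3 x) :=
      integral_add (hPos_int.add hErr_int) (hT1_int.add (hT2_int.sub hT3_int))
    have e2 : ∫ x, Pos x + Err x = (∫ x, Pos x) + ∫ x, Err x := integral_add hPos_int hErr_int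
    have e3 : ∫ x, T1 x + (T2 x - T3 x) = (∫ x, T1 x) + ∫ x, T2 x - T3 x := integral_add hT1_int (hT2_int.sub hT3_int)
    have e4 : ∫ x, T2 x - T3 x = (∫ x, T2 x) - ∫ x, T3 x := integral_sub hT2_int hT3_int
    rw [e1, e2, e3, e4, hI1, hI2, hI3]
    ring
  rw [hsplit]
  -- the squares are nonnegative, the errors are small
  have hPos : 0 ≤ ∫ x, Pos x := by
    refine integral_nonneg fun x => ?_
    have := hχ0 x
    simp only [hPosDef]
    positivity
  have hErr : -(3 * D / (2 * ε) * ∫ x, ‖v x‖ ^ 2) ≤ ∫ x, Err x := by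
    rw [← integral_const_mul, ← integral_neg]
    refine integral_mono ((hL2.const_mul _).neg) hErr_int fun x => ?_
    exact (abs_le.1 (abs_cutoff_error_le (v := v) hD hε x)).1
  linarith

/-! ### The sign lemma -/

/-- **THE AXIAL FLUX SIGN LEMMA** (Choi–Jeong's Lemma 3.3 as an inequality, Cartesian form).  Let `v : ℝ³ → ℝ³` be `C¹`, axisymmetric,
swirl-free and divergence-free, bounded (`‖v‖ ≤ B`), square-integrable, with integrable ledger density `|curl v|/r`.  Then
`0 ≤ ∫ v₂ · swirl(curl v)/r² dx` (`= ∫ v_z ω_θ / r dx = 2π∬ v_z ω_θ dr dz`).  [cite: ChoiJeong2025, Lemma 3.3 (arXiv:2110.09079 p. 12)] -/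
theorem integral_axialFlux_nonneg (hv : ContDiff ℝ 1 v) (hax : IsAxisymmetric v) (hsw : HasNoSwirl v)
    (hdiv : VectorCalculus.IsDivFree v) {B : ℝ} (hB : ∀ x, ‖v x‖ ≤ B) (hL2 : Integrable fun x => ‖v x‖ ^ 2)
    (hη : Integrable fun x => ‖curl v x‖ / cylRadius x) :
    0 ≤ ∫ x, v x 2 * (swirl (curl v) x / cylRadius x ^ 2) := by
  -- the truncation/regularisation sequence `ε_n = 1/(n+1)`, `R_n = (n+1)²`
  obtain ⟨C, hC0, hC⟩ := exists_norm_fderiv_cutoff_le (E := EuclideanSpace ℝ (Fin 3))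
  have hn1 : ∀ n : ℕ, (0 : ℝ) < (n : ℝ) + 1 := fun n => by positivity
  set F : ℕ → EuclideanSpace ℝ (Fin 3) → ℝ := fun n x =>
    cutoff (((n : ℝ) + 1) ^ 2) x * (x 0 ^ 2 + x 1 ^ 2 + (1 / ((n : ℝ) + 1)) ^ 2)⁻¹ * v x 2 * swirl (curl v) x with hF
  -- continuity facts
  have hωc : Continuous (curl v) := continuous_curl hv
  have hsc : Continuous (swirl (curl v)) := by
    rw [swirl_eq_inner_rotGen]
    exact (rotGenL.continuous).inner hωc
  have hv2c : Continuous fun x => v x 2 := (contDiff_apply_coord hv 2).continuous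
  -- STEP 1: `∫ F n → ∫ v₂ s / r²` (dominated convergence against `B · |curl v|/r`)
  have hlim : Tendsto (fun n => ∫ x, F n x) atTop (𝓝 (∫ x, v x 2 * (swirl (curl v) x / cylRadius x ^ 2))) := by
    refine tendsto_integral_of_dominated_convergence (fun x => B * (‖curl v x‖ / cylRadius x)) (fun n => ?_) (hη.const_mul B)
      (fun n => Eventually.of_forall fun x => ?_) (Eventually.of_forall fun x => ?_)
    · -- measurability: `F n` is continuous
      have hq : Continuous fun x : EuclideanSpace ℝ (Fin 3) => (x 0 ^ 2 + x 1 ^ 2 + (1 / ((n : ℝ) + 1)) ^ 2)⁻¹ :=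
        (contDiff_invSq (n := 1) (by positivity : (1 / ((n : ℝ) + 1)) ≠ 0)).continuous
      exact ((((contDiff_cutoff (n := 1) _).continuous.mul hq).mul hv2c).mul hsc).aestronglyMeasurable
    · -- domination
      rw [Real.norm_eq_abs]
      exact abs_truncated_integrand_le (fun y => abs_cutoff_le_one _ y) hB _ x
    · -- pointwise limit
      by_cases hr : cylRadius x = 0
      · have hs0 : swirl (curl v) x = 0 := swirl_eq_zero_of_cylRadius_eq_zero _ hr
        have h0 : ∀ n, F n x = 0 := fun n => by simp [hF, hs0]
        rw [hs0, zero_div, mul_zero]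
        exact tendsto_const_nhds.congr' (Eventually.of_forall fun n => (h0 n).symm)
      · have hrsq : cylRadius x ^ 2 = x 0 ^ 2 + x 1 ^ 2 := cylRadius_sq x
        have hpos : 0 < x 0 ^ 2 + x 1 ^ 2 := by rw [← hrsq]; positivity
        -- the cut-off is eventually `1` at `x`
        have hR : Tendsto (fun n : ℕ => ((n : ℝ) + 1) ^ 2) atTop atTop :=
          tendsto_atTop_mono (fun n => by nlinarith [(Nat.cast_nonneg n : (0 : ℝ) ≤ n)]) tendsto_natCast_atTop_atTop
        have hχ : Tendsto (fun n : ℕ => cutoff (((n : ℝ) + 1) ^ 2) x) atTop (𝓝 1) :=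
          tendsto_const_nhds.congr' ((hR.eventually (eventually_cutoff_eq_one x)).mono fun n hn => hn.symm)
        -- the regularised weight tends to `r⁻²`
        have hε0 : Tendsto (fun n : ℕ => (1 : ℝ) / ((n : ℝ) + 1)) atTop (𝓝 0) := tendsto_one_div_add_atTop_nhds_zero_nat
        have hq : Tendsto (fun n : ℕ => (x 0 ^ 2 + x 1 ^ 2 + (1 / ((n : ℝ) + 1)) ^ 2)⁻¹) atTop
            (𝓝 ((x 0 ^ 2 + x 1 ^ 2 + 0 ^ 2)⁻¹)) :=
          (tendsto_const_nhds.add (hε0.pow 2)).inv₀ (by positivity)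
        have hall := ((hχ.mul hq).mul (tendsto_const_nhds (x := v x 2))).mul (tendsto_const_nhds (x := swirl (curl v) x))
        have e : 1 * (x 0 ^ 2 + x 1 ^ 2 + 0 ^ 2)⁻¹ * v x 2 * swirl (curl v) x = v x 2 * (swirl (curl v) x / cylRadius x ^ 2) := by
          rw [hrsq]; ring
        rw [← e]
        exact hall
  -- STEP 2: each `∫ F n` is bounded below by `-(3C/2)/(n+1) · ∫‖v‖²`
  have hlow : ∀ n : ℕ, -(3 * (C / ((n : ℝ) + 1) ^ 2) / (2 * (1 / ((n : ℝ) + 1))) * ∫ x, ‖v x‖ ^ 2) ≤ ∫ x, F n x :=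
    fun n => integral_truncated_axialFlux_ge hv hax hsw hdiv hL2 (contDiff_cutoff (n := 1) _)
      (hasCompactSupport_cutoff (by positivity)) (fun y => cutoff_nonneg _ y) (hC _ (by positivity)) (by positivity)
  -- STEP 3: the lower bounds tend to `0`
  have hzero : Tendsto (fun n : ℕ => -(3 * (C / ((n : ℝ) + 1) ^ 2) / (2 * (1 / ((n : ℝ) + 1))) * ∫ x, ‖v x‖ ^ 2))
      atTop (𝓝 0) := by
    have e : ∀ n : ℕ, -(3 * (C / ((n : ℝ) + 1) ^ 2) / (2 * (1 / ((n : ℝ) + 1))) * ∫ x, ‖v x‖ ^ 2) =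
        (-(3 * C / 2 * ∫ x, ‖v x‖ ^ 2)) * (1 / ((n : ℝ) + 1)) := fun n => by
      field_simp
    simp_rw [e]
    have h := (tendsto_const_nhds (x := -(3 * C / 2 * ∫ x, ‖v x‖ ^ 2))).mul
      (tendsto_one_div_add_atTop_nhds_zero_nat (𝕜 := ℝ))
    rw [mul_zero] at h
    exact h
  exact le_of_tendsto_of_tendsto' hzero hlim hlow

end Summit.NavierStokesRegularity.NavierStokesRegularity.Theorems.PowerGaugeEulerLiouville.MirrorMoment

end
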